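import Summits.ResolutionOfSingularities.ResolutionOfSingularities.Theorems.EquisingularLiftEquisingularLiftNatDirStepUnobsOfTwoCharts
import HarnessLib

/-!
# [OURS · L1 W4.5(b) · EL♮(3) · nose residue, brick (P4-ν) supplier] The two-chart splitting `u = w'| − v|` on a projective-line-like
# pair of charts (Lipman's Laurent argument, abstract form)

Crux chain w45b, child EL♮(3) = stmt-ResolutionOfSingularities-20148; supplier of the `hsplit` input of
`Sections.dirStepUnobs_of_twoCharts` / `Sections.subsingleton_cechMH1_normalSheaf_of_twoCharts` (✓ p654480,
`…NatDirStepUnobsOfTwoCharts`): the COCHAIN form of `Ȟ¹((W₀, W₁); 𝒪_Z) = 0`. res-L1-w45b-nose-w3 g2 (WIDTH seat D-0157 DOOR 1),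
`--supports stmt-ResolutionOfSingularities-20148 --as helper`. OURS; NOT a statement of any manuscript; AI-written, weaker than expert
review. No `sorry`; standard axioms; DEF-FREE.

WHAT. **`twoChart_split_of_mul_eq_one`** — let `W₀, W₁, O` be opens of a scheme `Z` with `W₀` affine and `O = Z.basicOpen c` for a
section `c ∈ Γ(Z, W₀)` (so `Γ(Z, O) = Γ(Z, W₀)[1/c]`), `O ≤ W₁`, and `w ∈ Γ(Z, W₁)` with `c|_O · w|_O = 1`; suppose every section over
`W₀` is a polynomial in `c` with coefficients restricted from `Γ(Z, ⊤)`. Then EVERY `u ∈ Γ(Z, O)` is a difference `w'|_O − v|_O` with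
`v ∈ Γ(Z, W₀)`, `w' ∈ Γ(Z, W₁)`: write `u = s|/c|^N = (Σ_i p_i c^i)| · w|^N` and send the monomials with `i ≥ N` to `W₀` (`c^{i−N}`),
those with `i < N` to `W₁` (`w^{N−i}`) — Lipman's «every alternating one-cochain in `T[c/b, b/c]` is a coboundary» (Publ. Math. IHÉS 36
(1969), proof of Prop. (1.2) A), p. 200), here for the pair of charts of a `ℙ¹`-like curve (`c = ` affine coordinate near one pole,
`w = 1/c` near the other). **`dirStepUnobs_of_twoCharts_of_mul_eq_one`** — the socket form with this supplier plugged in: two affine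
charts with agreeing quasi-regular generators, `c`, `w` with `c · w = 1` on the overlap `= D(c)`, sections over the first chart polynomial
in `c` ⇒ `DirStepUnobs G E hE Γ hΓ`. Customers: the strict transform `Z′ ≅ ℙ¹` of a line through a blown-up point (charts `F₂[D₊(x₃), x₂/x₃]`
and `υ⁻¹D₊(x₂)`, `c = x₂/x₃`, `w = x₃/x₂`), Steiner's three lines, NOSE WORD v1.3 §3 row 1 (b).

References (index only): J. Lipman, Publ. Math. IHÉS 36 (1969), proof of Prop. (1.2) A), p. 200 [cite: Lipman1969]; R. Hartshorne,
*Algebraic Geometry* (1977), III.5 (Čech computation on `ℙ¹`) [cite: Hartshorne1977]; The Stacks Project, Tag 01ED [cite: StacksProject].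
-/

set_option linter.dupNamespace false -- mandated namespace `Summit.<Summit>.<Problem>` of this single-conjunct summit

noncomputable section

open CategoryTheory AlgebraicGeometry Opposite TopologicalSpace
open Literature.AlgebraicGeometry.Resolution (IsQuasiRegular)

namespace Summit.ResolutionOfSingularities.ResolutionOfSingularities.Cruxes.EquisingularLiftNat.Sections

universe u

/-- The Laurent monomial identity behind the splitting: if `c · w = 1` then `cⁱ · wᴺ` is `w^{N−i}` for `i < N` and `c^{i−N}` for
`N ≤ i`. [cite: Lipman1969, Proposition (1.2), proof of statement A) (p. 200)] (folklore) -/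
theorem pow_mul_pow_eq_of_mul_eq_one {R : Type*} [CommMonoid R] {c w : R} (hcw : c * w = 1) (i N : ℕ) :
    c ^ i * w ^ N = if i < N then w ^ (N - i) else c ^ (i - N) := by
  split_ifs with h
  · obtain ⟨d, rfl⟩ := Nat.exists_eq_add_of_lt h
    rw [show i + d + 1 - i = d + 1 by omega, show i + d + 1 = i + (d + 1) by omega, pow_add, ← mul_assoc, ← mul_pow, hcw,
      one_pow, one_mul]
  · obtain ⟨d, rfl⟩ := Nat.exists_eq_add_of_le (not_lt.mp h)
    rw [Nat.add_sub_cancel_left, pow_add, mul_comm (c ^ N), mul_assoc, ← mul_pow, hcw, one_pow, mul_one]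

/-- **The two-chart splitting (cochain form of `Ȟ¹((W₀, W₁); 𝒪_Z) = 0` for a `ℙ¹`-like pair of charts).** `W₀` affine,
`O = Z.basicOpen c ≤ W₁` for `c ∈ Γ(Z, W₀)`, `w ∈ Γ(Z, W₁)` with `c|_O · w|_O = 1`, and every section over `W₀` a polynomial in `c`
with coefficients from `Γ(Z, ⊤)`: then every `u ∈ Γ(Z, O)` is `w'|_O − v|_O` with `v ∈ Γ(Z, W₀)`, `w' ∈ Γ(Z, W₁)`.
[cite: Lipman1969, Proposition (1.2), proof of statement A) (p. 200)] (OURS abstract spelling; the argument is Lipman's) -/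
theorem twoChart_split_of_mul_eq_one {Z : Scheme.{u}} {W₀ W₁ O : Z.Opens} (hW₀ : IsAffineOpen W₀)
    (c : Γ(Z, W₀)) (w : Γ(Z, W₁)) (hO : O = Z.basicOpen c) (h₀ : O ≤ W₀) (h₁ : O ≤ W₁)
    (hcw : Z.presheaf.map (homOfLE h₀).op c * Z.presheaf.map (homOfLE h₁).op w = 1)
    (hT : ∀ s : Γ(Z, W₀), ∃ p : Polynomial Γ(Z, ⊤),
      s = p.eval₂ (Z.presheaf.map (homOfLE (le_top : W₀ ≤ ⊤)).op).hom c)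
    (u : Γ(Z, O)) :
    ∃ (v : Γ(Z, W₀)) (w' : Γ(Z, W₁)),
      u = Z.presheaf.map (homOfLE h₁).op w' - Z.presheaf.map (homOfLE h₀).op v := by
  subst hO
  -- the restriction maps
  set ρ₀ : Γ(Z, W₀) →+* Γ(Z, Z.basicOpen c) := (Z.presheaf.map (homOfLE h₀).op).hom with hρ₀
  set ρ₁ : Γ(Z, W₁) →+* Γ(Z, Z.basicOpen c) := (Z.presheaf.map (homOfLE h₁).op).hom with hρ₁
  set τ₀ : Γ(Z, ⊤) →+* Γ(Z, W₀) := (Z.presheaf.map (homOfLE (le_top : W₀ ≤ ⊤)).op).hom with hτ₀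
  set τ₁ : Γ(Z, ⊤) →+* Γ(Z, W₁) := (Z.presheaf.map (homOfLE (le_top : W₁ ≤ ⊤)).op).hom with hτ₁
  have hστ : ρ₀.comp τ₀ = ρ₁.comp τ₁ := by
    rw [hρ₀, hτ₀, hρ₁, hτ₁, ← CommRingCat.hom_comp, ← CommRingCat.hom_comp, ← Functor.map_comp, ← Functor.map_comp]
    rfl
  change ∃ v w', u = ρ₁ w' - ρ₀ v
  have hcw' : ρ₀ c * ρ₁ w = 1 := hcw
  -- `u · c|^N = s|` (the overlap is the basic open of the affine `W₀` at `c`)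
  haveI := hW₀.isLocalization_basicOpen c
  obtain ⟨⟨s, ⟨_, ⟨N, rfl⟩⟩⟩, hu⟩ := IsLocalization.surj (Submonoid.powers c) u
  have hu' : u * ρ₀ c ^ N = ρ₀ s := by
    have h : u * ρ₀ (c ^ N) = ρ₀ s := hu
    rwa [map_pow] at h
  -- `s = Σ_i p_i c^i`
  obtain ⟨p, hp⟩ := hT s
  -- `u = s| · w|^N = Σ_i p_i| · (c|^i · w|^N)`
  have hkey : u = ρ₀ s * ρ₁ w ^ N := by
    calc u = u * (ρ₀ c * ρ₁ w) ^ N := by rw [hcw', one_pow, mul_one]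
      _ = u * ρ₀ c ^ N * ρ₁ w ^ N := by rw [mul_pow, mul_assoc]
      _ = ρ₀ s * ρ₁ w ^ N := by rw [hu']
  rw [hp, Polynomial.eval₂_eq_sum_range, map_sum, Finset.sum_mul] at hkey
  simp only [map_mul, map_pow, mul_assoc] at hkey
  -- split the monomials: `i < N` goes to `W₁`, `N ≤ i` to `W₀`
  refine ⟨-(∑ i ∈ (Finset.range (p.natDegree + 1)).filter (fun i => ¬ i < N), τ₀ (p.coeff i) * c ^ (i - N)),
    ∑ i ∈ (Finset.range (p.natDegree + 1)).filter (fun i => i < N), τ₁ (p.coeff i) * w ^ (N - i), ?_⟩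
  rw [hkey, map_neg, sub_neg_eq_add, map_sum, map_sum,
    ← Finset.sum_filter_add_sum_filter_not (Finset.range (p.natDegree + 1)) (fun i => i < N)]
  congr 1
  · refine Finset.sum_congr rfl fun i hi => ?_
    rw [Finset.mem_filter] at hi
    rw [map_mul, map_pow, pow_mul_pow_eq_of_mul_eq_one hcw', if_pos hi.2, ← RingHom.comp_apply (hnp := ρ₀) (hmn := τ₀), hστ,
      RingHom.comp_apply]
  · refine Finset.sum_congr rfl fun i hi => ?_
    rw [Finset.mem_filter] at hi
    rw [map_mul, map_pow, pow_mul_pow_eq_of_mul_eq_one hcw', if_neg hi.2]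

/-- **(P4-ν) with the Laurent supplier plugged in — `DirStepUnobs` from two charts of a `ℙ¹`-like curve.** For the inclusion
`i₀ : Γ̃ ⟶ Ẽ` of the reduced structures (`Ẽ` locally Noetherian): two affine opens `V₀, V₁ ⊆ Ẽ` with affine intersection whose
preimages cover `Γ̃`, agreeing quasi-regular generators `x⁰, x¹` of the ideal of `i₀`, a section `c ∈ Γ(Γ̃, i₀⁻¹V₀)` with
`i₀⁻¹V₀ ∩ i₀⁻¹V₁ = D(c)` and an inverse `w ∈ Γ(Γ̃, i₀⁻¹V₁)` of `c` on the overlap, and every section over `i₀⁻¹V₀` a polynomial in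
`c` with coefficients from `Γ(Γ̃, ⊤)` ⇒ `DirStepUnobs G E hE Γ hΓ`. (Strict transform `≅ ℙ¹` of a line through a blown-up point:
`c = x₂/x₃` on `F₂[D₊(x₃), x₂/x₃]`, `w = x₃/x₂` on `υ⁻¹D₊(x₂)`.)
[OURS · L1 W4.5b · EL♮(3) · nose residue (P4-ν); NOT a statement of the manuscript] -/
theorem dirStepUnobs_of_twoCharts_of_mul_eq_one (G : Scheme.{0}) (E : Set G) (hE : IsClosed E) (Γ : Set G) (hΓ : IsClosed Γ)
    [IsLocallyNoetherian (redSub G E hE)]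
    (i₀ : redSub G Γ hΓ ⟶ redSub G E hE) [IsClosedImmersion i₀] (hi₀ : i₀ ≫ redSubι G E hE = redSubι G Γ hΓ)
    (V : Fin 2 → (redSub G E hE).affineOpens) (hV01 : IsAffineOpen ((V 0 : (redSub G E hE).Opens) ⊓ V 1))
    (hcov : (⨆ a, i₀ ⁻¹ᵁ (V a : (redSub G E hE).Opens)) = ⊤)
    {n : ℕ} (x : ∀ a : Fin 2, Fin n → Γ(redSub G E hE, (V a : (redSub G E hE).Opens)))
    (hqr : ∀ a, IsQuasiRegular (x a)) (hI : ∀ a, Ideal.span (Set.range (x a)) = i₀.ker.ideal (V a))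
    (hagree : ∀ j, (redSub G E hE).presheaf.map (homOfLE (inf_le_left : (V 0 : (redSub G E hE).Opens) ⊓ V 1 ≤ V 0)).op (x 0 j) =
      (redSub G E hE).presheaf.map (homOfLE (inf_le_right : (V 0 : (redSub G E hE).Opens) ⊓ V 1 ≤ V 1)).op (x 1 j))
    (c : Γ(redSub G Γ hΓ, i₀ ⁻¹ᵁ (V 0 : (redSub G E hE).Opens))) (w : Γ(redSub G Γ hΓ, i₀ ⁻¹ᵁ (V 1 : (redSub G E hE).Opens)))
    (hO : i₀ ⁻¹ᵁ (V 0 : (redSub G E hE).Opens) ⊓ i₀ ⁻¹ᵁ (V 1 : (redSub G E hE).Opens) = (redSub G Γ hΓ).basicOpen c)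
    (hcw : (redSub G Γ hΓ).presheaf.map (homOfLE inf_le_left).op c * (redSub G Γ hΓ).presheaf.map (homOfLE inf_le_right).op w =
      (1 : Γ(redSub G Γ hΓ, i₀ ⁻¹ᵁ (V 0 : (redSub G E hE).Opens) ⊓ i₀ ⁻¹ᵁ (V 1 : (redSub G E hE).Opens))))
    (hT : ∀ s : Γ(redSub G Γ hΓ, i₀ ⁻¹ᵁ (V 0 : (redSub G E hE).Opens)), ∃ p : Polynomial Γ(redSub G Γ hΓ, ⊤),
      s = p.eval₂ ((redSub G Γ hΓ).presheaf.map (homOfLE (le_top : i₀ ⁻¹ᵁ (V 0 : (redSub G E hE).Opens) ≤ ⊤)).op).hom c) :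
    DirStepUnobs G E hE Γ hΓ :=
  dirStepUnobs_of_twoCharts G E hE Γ hΓ i₀ hi₀ V hV01 hcov x hqr hI hagree fun u =>
    twoChart_split_of_mul_eq_one ((V 0).2.preimage i₀) c w hO inf_le_left inf_le_right hcw hT u

end Summit.ResolutionOfSingularities.ResolutionOfSingularities.Cruxes.EquisingularLiftNat.Sections

end
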